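import Summits.NavierStokesRegularity.NavierStokesRegularity.Theorems.ExtremiserTransienceNearExtremalTransienceExtremiserLiouvilleNewtonGradientDecay
import Literature.Analysis.FluidPDE.NewtonPotentialFarField
import Literature.Analysis.FluidPDE.LocalHelmholtzSupBound
import Literature.Analysis.FluidPDE.TaoEnstrophyLocalisation
import HarnessLib

/-!
# Crux `ExtremiserTransience.NearExtremalTransience` (stmt-NavierStokesRegularity-21883), line `extremiser_liouville`,
# stub K1b — THE NEWTONIAN VECTOR POTENTIAL `Γ ∗ B` OF A TEST FIELD: decay, derivatives, `curl`

`--supports stmt-NavierStokesRegularity-21883` (helper).  Author: prover seat `ns-el-k1b` (g6).  Potential theory for the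
blow-down vorticity law (`…ConstantSpeedBlowDownVorticity`): for `B ∈ C_c^∞(ℝ³;ℝ³)` the vector potential
`N[B](y) = ∫ Γ(y − x) B(x) dx` (`Γ = newtonKernel = −(4π|·|)⁻¹`) is smooth, lies in the decay class of
`…ConstantSpeedMultiplierExtension` (`‖N[B]‖ ≲ (1+‖y‖)⁻¹`, `‖DᵏN[B]‖ ≲ (1+‖y‖)⁻²`, `k = 1,2,3`), and `curl N[B] = N[curl B]`.
Scalar inputs: `…NewtonGradientDecay` (g5), `NewtonPotentialFarField`, `NewtonPotentialGradient{,FarField}`.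
* `exists_abs_newtonPotential_le{,_of_integral_eq_zero}`, `exists_norm_fderiv_newtonPotential_le'` : scalar decay
  `|N[φ]| ≲ (1+‖y‖)⁻¹` (`⁻²` for zero mean), `‖DN[φ]‖ ≲ (1+‖y‖)⁻²`.
* `vecNewton_eq_sum`, `contDiff_vecNewton`, `fderiv_vecNewton`, `curl_vecNewton` (`curl N[B] = N[curl B]`), `vecNewton_decay`.

WHAT THIS IS NOT: K1b is NOT proved; nothing here proves NS regularity. [folklore]
-/

noncomputable section

open Set Filter Topology MeasureTheory Metric Function
open scoped ENNReal NNReal Topology InnerProductSpace RealInnerProductSpace ContDiff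
open Literature.Analysis.FluidPDE Literature.Analysis

namespace Summit.NavierStokesRegularity.NavierStokesRegularity.Theorems

-- the problem directory repeats the summit name (`NavierStokesRegularity/NavierStokesRegularity`)
set_option linter.dupNamespace false

namespace ExtremiserLiouville

/-! ## Scalar potentials: decay of orders 0 and 1 for arbitrary mean -/

section Scalar

variable {φ : EuclideanSpace ℝ (Fin 3) → ℝ}

/-- `‖y‖⁻¹ ≤ (5/4)(1+‖y‖)⁻¹` for `‖y‖ ≥ 4`. [folklore] -/
theorem inv_norm_le_of_four_le {y : EuclideanSpace ℝ (Fin 3)} (hy : 4 ≤ ‖y‖) : ‖y‖⁻¹ ≤ 5 / 4 * (1 + ‖y‖)⁻¹ := by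
  have hy0 : 0 < ‖y‖ := by linarith
  rw [← div_eq_mul_inv, le_div_iff₀ (by positivity), ← div_eq_inv_mul, div_le_iff₀ hy0]; linarith

/-- `1 ≤ 5 (1+‖y‖)⁻¹` and `1 ≤ 25 ((1+‖y‖)²)⁻¹` for `‖y‖ < 4`. [folklore] -/
theorem one_le_of_norm_lt_four {y : EuclideanSpace ℝ (Fin 3)} (hy : ‖y‖ < 4) :
    1 ≤ 5 * (1 + ‖y‖)⁻¹ ∧ 1 ≤ 25 * ((1 + ‖y‖) ^ 2)⁻¹ := by
  have hy1 : 0 < 1 + ‖y‖ := by positivity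
  exact ⟨by rw [← div_eq_mul_inv, le_div_iff₀ hy1]; linarith,
    by rw [← div_eq_mul_inv, le_div_iff₀ (by positivity)]; nlinarith [norm_nonneg y]⟩

/-- `‖y‖⁻¹ ^ 2 ≤ (25/16)((1+‖y‖)²)⁻¹` for `‖y‖ ≥ 4`. [folklore] -/
theorem inv_norm_sq_le_of_four_le {y : EuclideanSpace ℝ (Fin 3)} (hy : 4 ≤ ‖y‖) :
    ‖y‖⁻¹ ^ 2 ≤ 25 / 16 * ((1 + ‖y‖) ^ 2)⁻¹ := by
  have h := inv_norm_le_of_four_le hy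
  have hy0 : 0 < ‖y‖ := by linarith
  have h' : (‖y‖⁻¹) ^ 2 ≤ (5 / 4 * (1 + ‖y‖)⁻¹) ^ 2 := pow_le_pow_left₀ (by positivity) h 2
  rwa [show (5 / 4 * (1 + ‖y‖)⁻¹) ^ 2 = 25 / 16 * ((1 + ‖y‖) ^ 2)⁻¹ by rw [mul_pow, inv_pow]; norm_num] at h'

/-- **`|N[φ](y)| ≤ C (1+‖y‖)⁻¹`** for every test function `φ` (monopole expansion for `‖y‖ ≥ 4`, the global sup bound
inside). [folklore] -/
theorem exists_abs_newtonPotential_le (hφ : ContDiff ℝ (⊤ : ℕ∞) φ) (hφc : HasCompactSupport φ) :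
    ∃ C : ℝ, 0 ≤ C ∧ ∀ y : EuclideanSpace ℝ (Fin 3), |∫ x, newtonKernel (y - x) * φ x| ≤ C * (1 + ‖y‖)⁻¹ := by
  obtain ⟨hi, hm, ⟨C₀, hC₀⟩, ⟨C₄, hC₄⟩⟩ := testFunction_bounds hφ hφc
  have hC₀0 : 0 ≤ C₀ := (abs_nonneg _).trans (hC₀ 0)
  have hC₄0 : 0 ≤ C₄ := le_trans (by positivity) (hC₄ 0)
  have hI0 : 0 ≤ ∫ x, |φ x| := integral_nonneg fun _ => abs_nonneg _
  have hI1 : 0 ≤ ∫ y, ‖y‖ * |φ y| := integral_nonneg fun _ => by positivity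
  obtain ⟨G₀, hG₀⟩ : ∃ G₀ : ℝ, G₀ = C₀ + (4 * Real.pi)⁻¹ * ∫ x, |φ x| := ⟨_, rfl⟩
  have hG₀0 : 0 ≤ G₀ := by rw [hG₀]; positivity
  have hnear : ∀ y, |∫ x, newtonKernel (y - x) * φ x| ≤ G₀ := fun y => by
    rw [hG₀]; exact abs_integral_newtonKernel_mul_le hφ.continuous hφc hC₀ y
  obtain ⟨Q, hQ⟩ : ∃ Q : ℝ, Q = ∫ x, φ x := ⟨_, rfl⟩
  obtain ⟨K, hK⟩ : ∃ K : ℝ, K = (7 / (2 * Real.pi)) * (∫ y, ‖y‖ * |φ y|) +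
    (3 * (volume : Measure (EuclideanSpace ℝ (Fin 3))).real (ball 0 1) / (8 * Real.pi)) * C₄ := ⟨_, rfl⟩
  have hK0 : 0 ≤ K := by rw [hK]; positivity
  have hfar : ∀ y : EuclideanSpace ℝ (Fin 3), 4 ≤ ‖y‖ →
      |(∫ x, newtonKernel (y - x) * φ x) - Q * newtonKernel y| ≤ K * ‖y‖⁻¹ ^ 2 := fun y hy => by
    rw [hK, hQ]; exact abs_integral_newtonKernel_mul_sub_le hi hm hC₄ hy
  obtain ⟨L, hL⟩ : ∃ L : ℝ, L = |Q| * (4 * Real.pi)⁻¹ + K / 4 := ⟨_, rfl⟩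
  have hL0 : 0 ≤ L := by rw [hL]; positivity
  refine ⟨5 * (G₀ + L), by positivity, fun y => ?_⟩
  have hy1 : 0 < 1 + ‖y‖ := by positivity
  have ht0 : 0 ≤ (1 + ‖y‖)⁻¹ := by positivity
  rcases lt_or_ge ‖y‖ 4 with hy | hy
  · have h5 := (one_le_of_norm_lt_four hy).1
    calc |∫ x, newtonKernel (y - x) * φ x| ≤ G₀ := hnear y
      _ ≤ G₀ * (5 * (1 + ‖y‖)⁻¹) := le_mul_of_one_le_right hG₀0 h5
      _ ≤ (G₀ + L) * (5 * (1 + ‖y‖)⁻¹) := mul_le_mul_of_nonneg_right (by linarith) (by positivity)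
      _ = 5 * (G₀ + L) * (1 + ‖y‖)⁻¹ := by ring
  · have hy0 : 0 < ‖y‖ := by linarith
    set u : ℝ := ‖y‖⁻¹ with hu
    have hu0 : 0 < u := inv_pos.2 hy0
    have hu4 : u ≤ 4⁻¹ := inv_anti₀ (by norm_num) hy
    have hΓ : |newtonKernel y| = (4 * Real.pi)⁻¹ * u := by rw [abs_newtonKernel, mul_inv]
    have h1 : |∫ x, newtonKernel (y - x) * φ x| ≤ |Q| * ((4 * Real.pi)⁻¹ * u) + K * u ^ 2 := by
      have := abs_sub_abs_le_abs_sub (∫ x, newtonKernel (y - x) * φ x) (Q * newtonKernel y)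
      rw [abs_mul, hΓ] at this
      linarith [hfar y hy]
    have h2 : K * u ^ 2 ≤ K / 4 * u := by
      have := mul_le_mul_of_nonneg_left hu4 (mul_nonneg hK0 hu0.le)
      calc K * u ^ 2 = K * u * u := by ring
        _ ≤ K * u * 4⁻¹ := this
        _ = K / 4 * u := by ring
    have h3 : |∫ x, newtonKernel (y - x) * φ x| ≤ L * u := by
      rw [hL, add_mul]; linarith
    have h4 : u ≤ 5 / 4 * (1 + ‖y‖)⁻¹ := inv_norm_le_of_four_le hy
    calc |∫ x, newtonKernel (y - x) * φ x| ≤ L * u := h3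
      _ ≤ L * (5 / 4 * (1 + ‖y‖)⁻¹) := mul_le_mul_of_nonneg_left h4 hL0
      _ ≤ 5 * (G₀ + L) * (1 + ‖y‖)⁻¹ := by nlinarith

/-- **`|N[φ](y)| ≤ C (1+‖y‖)⁻²` for a ZERO-MEAN test function** (no monopole). [folklore] -/
theorem exists_abs_newtonPotential_le_of_integral_eq_zero (hφ : ContDiff ℝ (⊤ : ℕ∞) φ) (hφc : HasCompactSupport φ)
    (h0 : ∫ x, φ x = 0) :
    ∃ C : ℝ, 0 ≤ C ∧ ∀ y : EuclideanSpace ℝ (Fin 3), |∫ x, newtonKernel (y - x) * φ x| ≤ C * ((1 + ‖y‖) ^ 2)⁻¹ := by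
  obtain ⟨hi, hm, ⟨C₀, hC₀⟩, ⟨C₄, hC₄⟩⟩ := testFunction_bounds hφ hφc
  have hC₀0 : 0 ≤ C₀ := (abs_nonneg _).trans (hC₀ 0)
  have hC₄0 : 0 ≤ C₄ := le_trans (by positivity) (hC₄ 0)
  have hI0 : 0 ≤ ∫ x, |φ x| := integral_nonneg fun _ => abs_nonneg _
  have hI1 : 0 ≤ ∫ y, ‖y‖ * |φ y| := integral_nonneg fun _ => by positivity
  obtain ⟨G₀, hG₀⟩ : ∃ G₀ : ℝ, G₀ = C₀ + (4 * Real.pi)⁻¹ * ∫ x, |φ x| := ⟨_, rfl⟩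
  have hG₀0 : 0 ≤ G₀ := by rw [hG₀]; positivity
  have hnear : ∀ y, |∫ x, newtonKernel (y - x) * φ x| ≤ G₀ := fun y => by
    rw [hG₀]; exact abs_integral_newtonKernel_mul_le hφ.continuous hφc hC₀ y
  obtain ⟨K, hK⟩ : ∃ K : ℝ, K = (7 / (2 * Real.pi)) * (∫ y, ‖y‖ * |φ y|) +
    (3 * (volume : Measure (EuclideanSpace ℝ (Fin 3))).real (ball 0 1) / (8 * Real.pi)) * C₄ := ⟨_, rfl⟩
  have hK0 : 0 ≤ K := by rw [hK]; positivity
  have hfar : ∀ y : EuclideanSpace ℝ (Fin 3), 4 ≤ ‖y‖ → |∫ x, newtonKernel (y - x) * φ x| ≤ K * ‖y‖⁻¹ ^ 2 := by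
    intro y hy
    have h := abs_integral_newtonKernel_mul_sub_le hi hm hC₄ hy
    rw [h0, zero_mul, sub_zero, ← hK] at h
    exact h
  refine ⟨25 * (G₀ + K), by positivity, fun y => ?_⟩
  have hy1 : 0 < 1 + ‖y‖ := by positivity
  have ht0 : 0 ≤ ((1 + ‖y‖) ^ 2)⁻¹ := by positivity
  rcases lt_or_ge ‖y‖ 4 with hy | hy
  · have h5 := (one_le_of_norm_lt_four hy).2
    calc |∫ x, newtonKernel (y - x) * φ x| ≤ G₀ := hnear y
      _ ≤ G₀ * (25 * ((1 + ‖y‖) ^ 2)⁻¹) := le_mul_of_one_le_right hG₀0 h5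
      _ ≤ (G₀ + K) * (25 * ((1 + ‖y‖) ^ 2)⁻¹) := mul_le_mul_of_nonneg_right (by linarith) (by positivity)
      _ = 25 * (G₀ + K) * ((1 + ‖y‖) ^ 2)⁻¹ := by ring
  · have h3 := inv_norm_sq_le_of_four_le hy
    calc |∫ x, newtonKernel (y - x) * φ x| ≤ K * ‖y‖⁻¹ ^ 2 := hfar y hy
      _ ≤ K * (25 / 16 * ((1 + ‖y‖) ^ 2)⁻¹) := mul_le_mul_of_nonneg_left h3 hK0
      _ ≤ 25 * (G₀ + K) * ((1 + ‖y‖) ^ 2)⁻¹ := by nlinarith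

/-- **`‖DN[φ](y)‖ ≤ C (1+‖y‖)⁻²`** for every test function `φ` (monopole expansion of the gradient for `‖y‖ ≥ 4`, the
global gradient bound inside). [folklore] -/
theorem exists_norm_fderiv_newtonPotential_le' (hφ : ContDiff ℝ (⊤ : ℕ∞) φ) (hφc : HasCompactSupport φ) :
    ∃ C : ℝ, 0 ≤ C ∧ ∀ y : EuclideanSpace ℝ (Fin 3),
      ‖fderiv ℝ (fun y => ∫ x, newtonKernel (y - x) * φ x) y‖ ≤ C * ((1 + ‖y‖) ^ 2)⁻¹ := by
  obtain ⟨hi, hm, ⟨C₀, hC₀⟩, ⟨C₄, hC₄⟩⟩ := testFunction_bounds hφ hφc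
  have hC₄0 : 0 ≤ C₄ := le_trans (by positivity) (hC₄ 0)
  have hI1 : 0 ≤ ∫ y, ‖y‖ * |φ y| := integral_nonneg fun _ => by positivity
  obtain ⟨B₁, hB₁⟩ := (hφ.continuous_fderiv (by simp)).bounded_above_of_compact_support (hφc.fderiv (𝕜 := ℝ))
  have hB₁0 : 0 ≤ B₁ := (norm_nonneg _).trans (hB₁ 0)
  have hID : 0 ≤ ∫ x, ‖fderiv ℝ φ x‖ := integral_nonneg fun _ => norm_nonneg _
  obtain ⟨G₁, hG₁⟩ : ∃ G₁ : ℝ, G₁ = B₁ + (4 * Real.pi)⁻¹ * ∫ x, ‖fderiv ℝ φ x‖ := ⟨_, rfl⟩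
  have hG₁0 : 0 ≤ G₁ := by rw [hG₁]; positivity
  have hnear : ∀ y, ‖fderiv ℝ (fun y => ∫ x, newtonKernel (y - x) * φ x) y‖ ≤ G₁ := fun y => by
    rw [hG₁]; exact norm_fderiv_integral_newtonKernel_mul_le hφ hφc hB₁ y
  obtain ⟨Q, hQ⟩ : ∃ Q : ℝ, Q = ∫ x, φ x := ⟨_, rfl⟩
  obtain ⟨K, hK⟩ : ∃ K : ℝ, K = (17 / (2 * Real.pi)) * (∫ y, ‖y‖ * |φ y|) +
    (3 * (volume : Measure (EuclideanSpace ℝ (Fin 3))).real (ball 0 1) / Real.pi) * C₄ := ⟨_, rfl⟩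
  have hK0 : 0 ≤ K := by rw [hK]; positivity
  have hfar : ∀ y : EuclideanSpace ℝ (Fin 3), 4 ≤ ‖y‖ → ∀ a : EuclideanSpace ℝ (Fin 3),
      |(∫ x, fderiv ℝ newtonKernel (y - x) a * φ x) - Q * fderiv ℝ newtonKernel y a| ≤ K * ‖a‖ * ‖y‖⁻¹ ^ 3 := by
    intro y hy a; rw [hK, hQ]; exact abs_integral_fderiv_newtonKernel_sub_monopole_le hi hm hC₄ hy a
  obtain ⟨L, hL⟩ : ∃ L : ℝ, L = |Q| * (4 * Real.pi)⁻¹ + K / 4 := ⟨_, rfl⟩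
  have hL0 : 0 ≤ L := by rw [hL]; positivity
  refine ⟨25 * (G₁ + L), by positivity, fun y => ?_⟩
  have hy1 : 0 < 1 + ‖y‖ := by positivity
  have ht0 : 0 ≤ ((1 + ‖y‖) ^ 2)⁻¹ := by positivity
  rcases lt_or_ge ‖y‖ 4 with hy | hy
  · have h5 := (one_le_of_norm_lt_four hy).2
    calc ‖fderiv ℝ (fun y => ∫ x, newtonKernel (y - x) * φ x) y‖ ≤ G₁ := hnear y
      _ ≤ G₁ * (25 * ((1 + ‖y‖) ^ 2)⁻¹) := le_mul_of_one_le_right hG₁0 h5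
      _ ≤ (G₁ + L) * (25 * ((1 + ‖y‖) ^ 2)⁻¹) := mul_le_mul_of_nonneg_right (by linarith) (by positivity)
      _ = 25 * (G₁ + L) * ((1 + ‖y‖) ^ 2)⁻¹ := by ring
  · have hy0 : 0 < ‖y‖ := by linarith
    set u : ℝ := ‖y‖⁻¹ with hu
    have hu0 : 0 < u := inv_pos.2 hy0
    have hu4 : u ≤ 4⁻¹ := inv_anti₀ (by norm_num) hy
    have hdir : ∀ a : EuclideanSpace ℝ (Fin 3),
        ‖fderiv ℝ (fun y => ∫ x, newtonKernel (y - x) * φ x) y a‖ ≤ L * u ^ 2 * ‖a‖ := by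
      intro a
      have ha : 0 ≤ ‖a‖ := norm_nonneg a
      rw [fderiv_newtonPotential_apply_eq_integral hφ hφc y a, Real.norm_eq_abs]
      have hΓ : |fderiv ℝ newtonKernel y a| ≤ (4 * Real.pi)⁻¹ * u ^ 2 * ‖a‖ := by
        rw [← Real.norm_eq_abs]
        refine ((fderiv ℝ newtonKernel y).le_opNorm a).trans (mul_le_mul_of_nonneg_right ?_ ha)
        have h := norm_fderiv_newtonKernel_le y
        rw [mul_inv, ← inv_pow] at h
        exact h
      have h1 : |∫ x, fderiv ℝ newtonKernel (y - x) a * φ x| ≤ |Q| * ((4 * Real.pi)⁻¹ * u ^ 2 * ‖a‖) + K * ‖a‖ * u ^ 3 := by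
        have := abs_sub_abs_le_abs_sub (∫ x, fderiv ℝ newtonKernel (y - x) a * φ x) (Q * fderiv ℝ newtonKernel y a)
        rw [abs_mul] at this
        have h' : |Q| * |fderiv ℝ newtonKernel y a| ≤ |Q| * ((4 * Real.pi)⁻¹ * u ^ 2 * ‖a‖) :=
          mul_le_mul_of_nonneg_left hΓ (abs_nonneg _)
        linarith [hfar y hy a]
      have h2 : K * ‖a‖ * u ^ 3 ≤ K / 4 * u ^ 2 * ‖a‖ := by
        have := mul_le_mul_of_nonneg_left hu4 (by positivity : 0 ≤ K * ‖a‖ * u ^ 2)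
        calc K * ‖a‖ * u ^ 3 = K * ‖a‖ * u ^ 2 * u := by ring
          _ ≤ K * ‖a‖ * u ^ 2 * 4⁻¹ := this
          _ = K / 4 * u ^ 2 * ‖a‖ := by ring
      calc |∫ x, fderiv ℝ newtonKernel (y - x) a * φ x|
          ≤ |Q| * ((4 * Real.pi)⁻¹ * u ^ 2 * ‖a‖) + K * ‖a‖ * u ^ 3 := h1
        _ ≤ |Q| * ((4 * Real.pi)⁻¹ * u ^ 2 * ‖a‖) + K / 4 * u ^ 2 * ‖a‖ := by linarith
        _ = L * u ^ 2 * ‖a‖ := by rw [hL]; ring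
    have hop : ‖fderiv ℝ (fun y => ∫ x, newtonKernel (y - x) * φ x) y‖ ≤ L * u ^ 2 :=
      ContinuousLinearMap.opNorm_le_bound _ (by positivity) hdir
    have h3 : u ^ 2 ≤ 25 / 16 * ((1 + ‖y‖) ^ 2)⁻¹ := inv_norm_sq_le_of_four_le hy
    calc ‖fderiv ℝ (fun y => ∫ x, newtonKernel (y - x) * φ x) y‖ ≤ L * u ^ 2 := hop
      _ ≤ L * (25 / 16 * ((1 + ‖y‖) ^ 2)⁻¹) := mul_le_mul_of_nonneg_left h3 hL0
      _ ≤ 25 * (G₁ + L) * ((1 + ‖y‖) ^ 2)⁻¹ := by nlinarith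

set_option maxSynthPendingDepth 3 in
/-- **All four orders at once**: for a scalar test function `φ`, `‖Dᵏ N[φ](y)‖ ≤ C (1+‖y‖)⁻²` for `k = 1, 2, 3` (orders
`2, 3` from `…NewtonGradientDecay`, which gives `(1+‖y‖)⁻³`). [folklore] -/
theorem exists_norm_iteratedFDeriv_newtonPotential_le (hφ : ContDiff ℝ (⊤ : ℕ∞) φ) (hφc : HasCompactSupport φ) :
    ∃ C : ℝ, 0 ≤ C ∧ ∀ k : ℕ, 1 ≤ k → k ≤ 3 → ∀ y : EuclideanSpace ℝ (Fin 3),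
      ‖iteratedFDeriv ℝ k (fun y => ∫ x, newtonKernel (y - x) * φ x) y‖ ≤ C * ((1 + ‖y‖) ^ 2)⁻¹ := by
  set N : EuclideanSpace ℝ (Fin 3) → ℝ := fun y => ∫ x, newtonKernel (y - x) * φ x with hN
  obtain ⟨C₁, hC₁0, hC₁⟩ := exists_norm_fderiv_newtonPotential_le' hφ hφc
  obtain ⟨C₂, hC₂0, hC₂⟩ := exists_norm_fderiv_fderiv_newtonPotential_le hφ hφc
  obtain ⟨C₃, hC₃0, hC₃⟩ := exists_norm_fderiv3_newtonPotential_apply_le hφ hφc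
  refine ⟨C₁ + C₂ + C₃, by positivity, fun k hk1 hk3 y => ?_⟩
  have hy1 : 1 ≤ 1 + ‖y‖ := by linarith [norm_nonneg y]
  have h32 : ((1 + ‖y‖) ^ 3)⁻¹ ≤ ((1 + ‖y‖) ^ 2)⁻¹ :=
    inv_anti₀ (by positivity) (pow_le_pow_right₀ hy1 (by norm_num))
  have hE0 : 0 ≤ ((1 + ‖y‖) ^ 2)⁻¹ := by positivity
  interval_cases k
  · rw [← norm_iteratedFDeriv_fderiv, norm_iteratedFDeriv_zero]
    calc ‖fderiv ℝ N y‖ ≤ C₁ * ((1 + ‖y‖) ^ 2)⁻¹ := hC₁ y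
      _ ≤ (C₁ + C₂ + C₃) * ((1 + ‖y‖) ^ 2)⁻¹ := by nlinarith
  · rw [← norm_iteratedFDeriv_fderiv, ← norm_iteratedFDeriv_fderiv, norm_iteratedFDeriv_zero]
    calc ‖fderiv ℝ (fderiv ℝ N) y‖ ≤ C₂ * ((1 + ‖y‖) ^ 3)⁻¹ := hC₂ y
      _ ≤ C₂ * ((1 + ‖y‖) ^ 2)⁻¹ := mul_le_mul_of_nonneg_left h32 hC₂0
      _ ≤ (C₁ + C₂ + C₃) * ((1 + ‖y‖) ^ 2)⁻¹ := by nlinarith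
  · rw [← norm_iteratedFDeriv_fderiv, ← norm_iteratedFDeriv_fderiv, ← norm_iteratedFDeriv_fderiv, norm_iteratedFDeriv_zero]
    have hop : ‖fderiv ℝ (fderiv ℝ (fderiv ℝ N)) y‖ ≤ C₃ * ((1 + ‖y‖) ^ 3)⁻¹ :=
      ContinuousLinearMap.opNorm_le_bound _ (by positivity) fun h => hC₃ y h
    calc ‖fderiv ℝ (fderiv ℝ (fderiv ℝ N)) y‖ ≤ C₃ * ((1 + ‖y‖) ^ 3)⁻¹ := hop
      _ ≤ C₃ * ((1 + ‖y‖) ^ 2)⁻¹ := mul_le_mul_of_nonneg_left h32 hC₃0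
      _ ≤ (C₁ + C₂ + C₃) * ((1 + ‖y‖) ^ 2)⁻¹ := by nlinarith

end Scalar


/-! ## The vector potential `N[B](y) = ∫ Γ(y − x) B(x) dx` -/

section Vector

variable {B : EuclideanSpace ℝ (Fin 3) → EuclideanSpace ℝ (Fin 3)}

/-- Expansion of a vector in the standard frame: `v = Σᵢ vᵢ eᵢ`. [folklore] -/
theorem eq_sum_smul_single (v : EuclideanSpace ℝ (Fin 3)) :
    v = ∑ i : Fin 3, v i • EuclideanSpace.single i (1 : ℝ) := by
  ext j
  fin_cases j <;> simp [Fin.sum_univ_three]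

/-- The components `x ↦ B x i` of a test field are scalar test functions. [folklore] -/
theorem testField_apply (hB : ContDiff ℝ (⊤ : ℕ∞) B) (hBc : HasCompactSupport B) (i : Fin 3) :
    ContDiff ℝ (⊤ : ℕ∞) (fun x => B x i) ∧ HasCompactSupport (fun x => B x i) :=
  ⟨(EuclideanSpace.proj (𝕜 := ℝ) i).contDiff.comp hB, hBc.comp_left (g := fun v : EuclideanSpace ℝ (Fin 3) => v i) rfl⟩

/-- `D(x ↦ B x i)(x) h = (DB(x) h) i`. [folklore] -/
theorem fderiv_apply_eq (hB : ContDiff ℝ (⊤ : ℕ∞) B) (x h : EuclideanSpace ℝ (Fin 3)) (i : Fin 3) :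
    fderiv ℝ (fun x => B x i) x h = fderiv ℝ B x h i := by
  have hd : DifferentiableAt ℝ B x := (hB.differentiable (by simp)) x
  have e : (fun x => B x i) = (EuclideanSpace.proj (𝕜 := ℝ) i) ∘ B := rfl
  rw [e, fderiv_comp x (EuclideanSpace.proj (𝕜 := ℝ) i).differentiableAt hd, (EuclideanSpace.proj (𝕜 := ℝ) i).fderiv]
  rfl

/-- **`N[B](y) = Σᵢ N[Bᵢ](y) eᵢ`**: the vector potential through the scalar potentials of the components. [folklore] -/
theorem vecNewton_eq_sum (hB : Continuous B) (hBc : HasCompactSupport B) :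
    (fun y => ∫ x, newtonKernel (y - x) • B x) =
      fun y => ∑ i : Fin 3, (∫ x, newtonKernel (y - x) * B x i) • EuclideanSpace.single i (1 : ℝ) := by
  funext y
  have hi : ∀ i : Fin 3, Integrable fun x => newtonKernel (y - x) * B x i := fun i => by
    have hc : Continuous fun x => B x i := (EuclideanSpace.proj (𝕜 := ℝ) i).continuous.comp hB
    have hs : HasCompactSupport fun x => B x i := hBc.comp_left (g := fun v : EuclideanSpace ℝ (Fin 3) => v i) rfl
    have h := integrable_newtonKernel_smul (F := ℝ) hc hs y
    simpa only [smul_eq_mul] using h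
  have hexp : (fun x => newtonKernel (y - x) • B x) =
      fun x => ∑ i : Fin 3, (newtonKernel (y - x) * B x i) • EuclideanSpace.single i (1 : ℝ) := by
    funext x
    conv_lhs => rw [eq_sum_smul_single (B x)]
    rw [Finset.smul_sum]
    refine Finset.sum_congr rfl fun i _ => ?_
    rw [smul_smul]
  rw [hexp, integral_finsetSum _ fun i _ => (hi i).smul_const _]
  refine Finset.sum_congr rfl fun i _ => ?_
  rw [integral_smul_const]

/-- **`N[B]` is smooth.** [folklore] -/
theorem contDiff_vecNewton (hB : ContDiff ℝ (⊤ : ℕ∞) B) (hBc : HasCompactSupport B) :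
    ContDiff ℝ (⊤ : ℕ∞) fun y => ∫ x, newtonKernel (y - x) • B x := by
  rw [vecNewton_eq_sum hB.continuous hBc]
  refine ContDiff.sum fun i _ => ?_
  obtain ⟨hBi, hBic⟩ := testField_apply hB hBc i
  exact (contDiff_integral_newtonKernel_mul hBi hBic).smul contDiff_const

/-- **The derivative falls on the test field**: `DN[B](y) = ∫ Γ(y − x) DB(x) dx` (an integral of operators). [folklore] -/
theorem fderiv_vecNewton (hB : ContDiff ℝ (⊤ : ℕ∞) B) (hBc : HasCompactSupport B) (y : EuclideanSpace ℝ (Fin 3)) :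
    fderiv ℝ (fun y => ∫ x, newtonKernel (y - x) • B x) y = ∫ x, newtonKernel (y - x) • fderiv ℝ B x := by
  have hDBc : Continuous (fderiv ℝ B) := hB.continuous_fderiv (by simp)
  have hDBs : HasCompactSupport (fderiv ℝ B) := hBc.fderiv (𝕜 := ℝ)
  have hint : Integrable fun x => newtonKernel (y - x) • fderiv ℝ B x := integrable_newtonKernel_smul hDBc hDBs y
  ext h i
  rw [ContinuousLinearMap.integral_apply hint h]
  simp only [FunLike.coe_smul, Pi.smul_apply]
  have hBh : Continuous fun x => fderiv ℝ B x h := hDBc.clm_apply continuous_const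
  have hBhc : HasCompactSupport fun x => fderiv ℝ B x h := hBc.fderiv_apply (𝕜 := ℝ) h
  have hR := congrFun (vecNewton_eq_sum hBh hBhc) y
  simp only at hR
  rw [hR]
  have hL : fderiv ℝ (fun y => ∫ x, newtonKernel (y - x) • B x) y h =
      ∑ i : Fin 3, (∫ x, newtonKernel (y - x) * fderiv ℝ B x h i) • EuclideanSpace.single i (1 : ℝ) := by
    rw [vecNewton_eq_sum hB.continuous hBc]
    have hd : ∀ i : Fin 3, DifferentiableAt ℝ (fun y => (∫ x, newtonKernel (y - x) * B x i) • EuclideanSpace.single i (1 : ℝ)) y := by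
      intro i
      obtain ⟨hBi, hBic⟩ := testField_apply hB hBc i
      exact (((contDiff_integral_newtonKernel_mul hBi hBic).differentiable (by simp)) y).smul_const _
    rw [fderiv_fun_sum fun i _ => hd i, FunLike.coe_sum, Finset.sum_apply]
    refine Finset.sum_congr rfl fun i _ => ?_
    obtain ⟨hBi, hBic⟩ := testField_apply hB hBc i
    have hdi : DifferentiableAt ℝ (fun y => ∫ x, newtonKernel (y - x) * B x i) y :=
      ((contDiff_integral_newtonKernel_mul hBi hBic).differentiable (by simp)) y
    rw [fderiv_smul_const hdi, ContinuousLinearMap.smulRight_apply, fderiv_integral_newtonKernel_mul_apply hBi hBic y h]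
    congr 1
    refine integral_congr_ae (Eventually.of_forall fun x => ?_)
    simp only
    rw [fderiv_apply_eq hB x h i]
  rw [hL]

/-- **`curl N[B] = N[curl B]`** (the curl passes under the integral onto the test field). [folklore] -/
theorem curl_vecNewton (hB : ContDiff ℝ (⊤ : ℕ∞) B) (hBc : HasCompactSupport B) (y : EuclideanSpace ℝ (Fin 3)) :
    curl (fun y => ∫ x, newtonKernel (y - x) • B x) y = ∫ x, newtonKernel (y - x) • curl B x := by
  have hDBc : Continuous (fderiv ℝ B) := hB.continuous_fderiv (by simp)
  have hDBs : HasCompactSupport (fderiv ℝ B) := hBc.fderiv (𝕜 := ℝ)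
  have hint : Integrable fun x => newtonKernel (y - x) • fderiv ℝ B x := integrable_newtonKernel_smul hDBc hDBs y
  rw [curl_eq_curlCLM, fderiv_vecNewton hB hBc y, ← ContinuousLinearMap.integral_comp_comm curlCLM hint]
  refine integral_congr_ae (Eventually.of_forall fun x => ?_)
  simp only [map_smul, curl_eq_curlCLM]

/-- **`N[B]` lies in the decay class**: `‖N[B](y)‖ ≤ C(1+‖y‖)⁻¹` and `‖DᵏN[B](y)‖ ≤ C(1+‖y‖)⁻²` for `k = 1, 2, 3`. [folklore] -/
theorem vecNewton_decay (hB : ContDiff ℝ (⊤ : ℕ∞) B) (hBc : HasCompactSupport B) :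
    ∃ C : ℝ, 0 ≤ C ∧ (∀ y, ‖(fun y => ∫ x, newtonKernel (y - x) • B x) y‖ ≤ C * (1 + ‖y‖)⁻¹) ∧
      ∀ k : ℕ, 1 ≤ k → k ≤ 3 → ∀ y,
        ‖iteratedFDeriv ℝ k (fun y => ∫ x, newtonKernel (y - x) • B x) y‖ ≤ C * ((1 + ‖y‖) ^ 2)⁻¹ := by
  have h0 : ∀ i : Fin 3, ∃ C : ℝ, 0 ≤ C ∧ ∀ y : EuclideanSpace ℝ (Fin 3),
      |∫ x, newtonKernel (y - x) * B x i| ≤ C * (1 + ‖y‖)⁻¹ := fun i =>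
    exists_abs_newtonPotential_le (testField_apply hB hBc i).1 (testField_apply hB hBc i).2
  have hk : ∀ i : Fin 3, ∃ C : ℝ, 0 ≤ C ∧ ∀ k : ℕ, 1 ≤ k → k ≤ 3 → ∀ y : EuclideanSpace ℝ (Fin 3),
      ‖iteratedFDeriv ℝ k (fun y => ∫ x, newtonKernel (y - x) * B x i) y‖ ≤ C * ((1 + ‖y‖) ^ 2)⁻¹ := fun i =>
    exists_norm_iteratedFDeriv_newtonPotential_le (testField_apply hB hBc i).1 (testField_apply hB hBc i).2
  choose C0 hC00 hC0 using h0
  choose Ck hCk0 hCk using hk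
  refine ⟨∑ i, (C0 i + Ck i), Finset.sum_nonneg fun i _ => add_nonneg (hC00 i) (hCk0 i), fun y => ?_, fun k hk1 hk3 y => ?_⟩
  · rw [vecNewton_eq_sum hB.continuous hBc]
    simp only
    refine (norm_sum_le _ _).trans ?_
    rw [Finset.sum_mul]
    refine Finset.sum_le_sum fun i _ => ?_
    rw [norm_smul, PiLp.norm_single, norm_one, mul_one, Real.norm_eq_abs]
    have : 0 ≤ Ck i * (1 + ‖y‖)⁻¹ := mul_nonneg (hCk0 i) (by positivity)
    calc |∫ x, newtonKernel (y - x) * B x i| ≤ C0 i * (1 + ‖y‖)⁻¹ := hC0 i y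
      _ ≤ (C0 i + Ck i) * (1 + ‖y‖)⁻¹ := by rw [add_mul]; linarith
  · rw [vecNewton_eq_sum hB.continuous hBc]
    have hsm : ∀ i : Fin 3, ContDiff ℝ (⊤ : ℕ∞) (fun y => ∫ x, newtonKernel (y - x) * B x i) := fun i =>
      contDiff_integral_newtonKernel_mul (testField_apply hB hBc i).1 (testField_apply hB hBc i).2
    rw [iteratedFDeriv_fun_sum_apply
      (f := fun i y => (∫ x, newtonKernel (y - x) * B x i) • EuclideanSpace.single i (1 : ℝ))
      fun i _ => (((hsm i).smul contDiff_const).of_le (by exact_mod_cast le_top)).contDiffAt]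
    refine (norm_sum_le _ _).trans ?_
    rw [Finset.sum_mul]
    refine Finset.sum_le_sum fun i _ => ?_
    rw [iteratedFDeriv_smul_const_apply (((hsm i).of_le (by exact_mod_cast le_top)).contDiffAt)]
    refine (ContinuousLinearMap.norm_compContinuousMultilinearMap_le _ _).trans ?_
    have hn : ‖(ContinuousLinearMap.id ℝ ℝ).smulRight (EuclideanSpace.single i (1 : ℝ))‖ ≤ 1 := by
      rw [ContinuousLinearMap.norm_smulRight_apply, PiLp.norm_single, norm_one, mul_one]
      exact ContinuousLinearMap.norm_id_le
    have : 0 ≤ C0 i * ((1 + ‖y‖) ^ 2)⁻¹ := mul_nonneg (hC00 i) (by positivity)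
    calc ‖(ContinuousLinearMap.id ℝ ℝ).smulRight (EuclideanSpace.single i (1 : ℝ))‖ *
          ‖iteratedFDeriv ℝ k (fun y => ∫ x, newtonKernel (y - x) * B x i) y‖
        ≤ 1 * (Ck i * ((1 + ‖y‖) ^ 2)⁻¹) := mul_le_mul hn (hCk i k hk1 hk3 y) (norm_nonneg _) zero_le_one
      _ ≤ (C0 i + Ck i) * ((1 + ‖y‖) ^ 2)⁻¹ := by rw [one_mul, add_mul]; linarith

end Vector

end ExtremiserLiouville

end Summit.NavierStokesRegularity.NavierStokesRegularity.Theorems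

end
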